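import Summits.KontsevichZagierPeriods.Zeta5Search.Barrier.ConeGammaCuspEndGermsOsc

/-!
# ζ(5) search — BARRIER: THE EXACT D-FORM — a junction's vote is a finite sum over the cells of its flip set

HONEST FRAMING (cell `pub-zeta5`): systematic search; no irrationality claim unless kernel-certified. MODEL objects
under Brown–Zudilin's (28)+(30) accounting ([BZ22] = arXiv:2210.03391; (28) observed, not proved); nothing here is a
statement about `ζ(5)`, any `γ` of record, the cone's supremum (C2 OPEN) or the VALUE of any vote / pattern defect
at a named direction (those are DATA of the cell); S-E stays CONJECTURED; records in print UNMOVED. Prover P2 g27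
(item (a) of P2 g26's successor menu «the exact D-form at ≥ 3 walls»; plan INBOX 2026-08-27 l.9273).

At a breakpoint `b ∈ bkpts a T` of the orbit `u ↦ u·s(a)` the symmetric part of the cusp slope receives the four-germ
sum `R_b(δ) = germR(δ) + germL(δ) + germR(−δ) + germL(−δ)` (`ConeGammaCuspSymmetric`, `…Slope`). Along the LOCAL LINE
`x ↦ Δ_x = η·(x·s(a) + δ)` the member form `k` (`b·h_k(a) ∈ ℤ`) reads `φ_k(Δ_x) = η·(x·h_k + φ_k(δ))` (`phiForm_disp`),
so it changes sign exactly at the FLIP POINT `c_k = −φ_k(δ)/h_k(a) ∈ (−W, W)` (`abs_flip_lt_clusterWidth`). The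
REFLECTION DEFECT of the line, `P(x) = 𝒩(θ_b + Δ_x) + 𝒩(θ_b − Δ_x) − 𝒩(θ_b + t·s) − 𝒩(θ_b − t·s)` (`θ_b = b·s(a)`, `t` a
line step below the walls), depends on `x ∈ [−W, W]` only through the member-sign pattern `{k : x > c_k}`
(`torusN_pair_eq_of_member_signs`): it is a STEP FUNCTION of `x`.
* `intervalIntegrable_torusN_affine`, `intervalIntegrable_reflDefect_line` — integrability of `P`;
* **`germ_symm_eq_integral_fold`** — `R_b(δ) = ∫_{−W}^{W} P(x) dx` (fold of g25's reflection form
  `germ_symm_eq_integral_refl`: the `−δ` half is the mirror image `x ↦ −x` of the `+δ` half);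
* **`pair_line_eq_of_same_signs`** / `reflDefect_line_eq_of_same_signs` — CELL CONSTANCY: `𝒩(θ_b+Δ_x) + 𝒩(θ_b−Δ_x) = 𝒩(θ_b+Δ_y) + 𝒩(θ_b−Δ_y)` whenever every
  member form has the same strict sign at `x` and `y`; **`reflDefect_line_eq_zero_of_pos` / `_of_neg`** — `P(x) = 0`
  when all member forms are positive (right of the last flip point) or all negative (left of the first);
* `chain_mono` / `chain_strictMono`, `line_form_eq_mul_sub` — bookkeeping of a partition `c_0 < c_1 < ⋯ < c_n`;
* **`germ_symm_eq_sum_cells` — THE EXACT D-FORM AT ANY WALL COUNT**: for EVERY partition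
  `−W = c_0 < c_1 < ⋯ < c_n = W` passing through all member flip points,
  `R_b(δ) = Σ_{j<n} (c_{j+1} − c_j) · P((c_j + c_{j+1})/2)` — the vote is the finite sum of (cell length) × (pattern
  defect of the cell); two walls: one mixed cell of length `|r₁ − r₂|` (g25's `germ_symm_eq_two_wall`); the spread bound
  of g26 (`abs_germ_symm_le_spread`) is its absolute shadow;
* **`reflDefect_cell_first` / `reflDefect_cell_last`** — the two OUTER cells of such a partition carry defect `0` (this
  is what makes the Abel / jump form of the companion file `ConeGammaCuspSymmetricJumps` boundary-free).
DESK (DATA, `HOME/pub-zeta5-p2/g27/alg/dform.py`, exact rationals on P2 g11's sealed `se2.py` via P2 g25's `sympart`):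
the partition form equals `K_b(v) + K_b(−v)` with 0 failures at every multi-wall junction × displacement of record/41,
flag/60, argmax-120, t*/480 (12,143 pairs; up to 26 cells at one junction). NOT here (honest): the value of any `P` at a
named direction, anything about `γ`, C2, S-E, `ζ(5)`.
-/

noncomputable section

open Set MeasureTheory
open scoped Topology

namespace Summit.KontsevichZagierPeriods.Zeta5Search.Barrier.ConeGamma

/-! ### The local line `x ↦ η·(x·s(a) + δ)`: forms, flip points, integrability -/

/-- **Forms of the local-line displacement**: `φ_k(η·(x·s(a) + δ)) = η·(x·h_k(a) + φ_k(δ))`. -/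
theorem phiForm_disp (a : Dir) (η x : ℝ) (δ : Fin 8 → ℝ) (k : Fin 28) :
    phiForm (η • (x • sParam a + δ)) k = η * (x * h28 a k + phiForm δ k) := by
  rw [show η • (x • sParam a + δ) = η • (x • sParam a) + η • δ by rw [smul_add], phiForm_add, smul_smul,
    phiForm_smul_sParam, phiForm_eq (η • δ), pairForm_smul, ← phiForm_eq]
  ring

/-- **The flip points lie inside `(−W, W)`**: `|φ_k(δ)/h_k(a)| < W(a,δ)` for every form (indeed `≤ W − 1 = Y/x_min`). -/
theorem abs_flip_lt_clusterWidth {a : Dir} (hpos : ∀ k, 0 < h28 a k) (δ : Fin 8 → ℝ) (k : Fin 28) :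
    |phiForm δ k / h28 a k| < clusterWidth a δ := by
  have hk := hpos k
  rw [abs_div, abs_of_pos hk, div_lt_iff₀ hk]
  unfold clusterWidth
  have h1 := abs_phiForm_le_shiftSize δ k
  have h2 := shiftSize_le_div_mul hpos δ k
  nlinarith

/-- The member form along the local line, factored at a flip point: if `c = −φ_k(δ)/h_k(a)` then
`x·h_k + φ_k(δ) = h_k·(x − c)`. -/
theorem line_form_eq_mul_sub {a : Dir} {k : Fin 28} (hk : 0 < h28 a k) {δ : Fin 8 → ℝ} {c x : ℝ}
    (hc : c = -(phiForm δ k / h28 a k)) : x * h28 a k + phiForm δ k = h28 a k * (x - c) := by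
  rw [hc]
  field_simp
  ring

/-- `x ↦ 𝒩((b + ηx)·s(a) + c)` is interval integrable (measurable along affine lines, bounded by `7`). -/
theorem intervalIntegrable_torusN_affine (a : Dir) (c : Fin 8 → ℝ) (b η α β : ℝ) :
    IntervalIntegrable (fun x : ℝ => (torusN ((b + η * x) • sParam a + c) : ℝ)) volume α β := by
  have haff : Measurable fun x : ℝ => b + η * x := measurable_const.add (measurable_const.mul measurable_id)
  have hm : Measurable fun x : ℝ => (torusN ((b + η * x) • sParam a + c) : ℝ) :=
    (measurable_torusN_line a c).comp haff
  refine IntervalIntegrable.mono_fun' (g := fun _ => (7 : ℝ)) intervalIntegrable_const hm.aestronglyMeasurable ?_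
  exact Filter.Eventually.of_forall fun x => by
    simp only [Real.norm_eq_abs]
    exact abs_torusN_le_seven _

/-- The two points of the reflected pair as affine-line points:
`θ_b + η(x·s + δ) = (b + ηx)·s + ηδ` and `θ_b − η(x·s + δ) = (b + (−η)x)·s + (−η)δ`. -/
theorem bkpt_disp_affine (a : Dir) (b η x : ℝ) (δ : Fin 8 → ℝ) :
    b • sParam a + η • (x • sParam a + δ) = (b + η * x) • sParam a + η • δ ∧
    b • sParam a - η • (x • sParam a + δ) = (b + (-η) * x) • sParam a + (-η) • δ := by
  constructor
  · ext i; simp only [Pi.add_apply, Pi.smul_apply, smul_eq_mul]; ring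
  · ext i; simp only [Pi.add_apply, Pi.sub_apply, Pi.smul_apply, smul_eq_mul]; ring

/-- **The reflection defect of the local line is interval integrable** (on any interval). -/
theorem intervalIntegrable_reflDefect_line (a : Dir) (b η t : ℝ) (δ : Fin 8 → ℝ) (α β : ℝ) :
    IntervalIntegrable (fun x : ℝ =>
      (torusN (b • sParam a + η • (x • sParam a + δ)) : ℝ) + torusN (b • sParam a - η • (x • sParam a + δ)) -
        (torusN (b • sParam a + t • sParam a) + torusN (b • sParam a - t • sParam a))) volume α β := by
  have e : (fun x : ℝ =>
      (torusN (b • sParam a + η • (x • sParam a + δ)) : ℝ) + torusN (b • sParam a - η • (x • sParam a + δ)) -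
        (torusN (b • sParam a + t • sParam a) + torusN (b • sParam a - t • sParam a))) =
      fun x : ℝ => (torusN ((b + η * x) • sParam a + η • δ) : ℝ) +
        torusN ((b + (-η) * x) • sParam a + (-η) • δ) -
        (torusN (b • sParam a + t • sParam a) + torusN (b • sParam a - t • sParam a)) := by
    funext x
    rw [(bkpt_disp_affine a b η x δ).1, (bkpt_disp_affine a b η x δ).2]
  rw [e]
  exact ((intervalIntegrable_torusN_affine a _ b η α β).add
    (intervalIntegrable_torusN_affine a _ b (-η) α β)).sub intervalIntegrable_const

/-- The mirror image of the local line: `θ_b ± η(w·s − δ) = θ_b ∓ η((−w)·s + δ)`. -/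
theorem bkpt_disp_mirror (a : Dir) (b η w : ℝ) (δ : Fin 8 → ℝ) :
    b • sParam a + η • (w • sParam a + -δ) = b • sParam a - η • ((-w) • sParam a + δ) ∧
    b • sParam a - η • (w • sParam a + -δ) = b • sParam a + η • ((-w) • sParam a + δ) := by
  constructor
  · ext i; simp only [Pi.add_apply, Pi.sub_apply, Pi.smul_apply, Pi.neg_apply, smul_eq_mul]; ring
  · ext i; simp only [Pi.add_apply, Pi.sub_apply, Pi.smul_apply, Pi.neg_apply, smul_eq_mul]; ring

/-! ### The fold: `R_b(δ) = ∫_{−W}^{W} P` -/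

/-- **THE FOLDED REFLECTION FORM.** Let all 28 forms of `a` be positive, `b ∈ bkpts a T`, `δ` a displacement, `0 < η`
with `ηK < 1` and `ηK < wallDist a T`, and `t > 0` a line step with `t·x_max < 1`, `t·x_max < wallDist a T`. Then
`germR(δ) + germL(δ) + germR(−δ) + germL(−δ) = ∫_{−W}^{W} P(x) dx` with
`P(x) = 𝒩(θ_b + η(x·s+δ)) + 𝒩(θ_b − η(x·s+δ)) − (𝒩(θ_b + t·s) + 𝒩(θ_b − t·s))`: by g25's `refl_integrand_eq_defects` the
reflection-form integrand at `w ∈ (0, W]` is `P(w) + P(−w)` (the `−δ` defect is the `+δ` defect at `−w`,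
`bkpt_disp_mirror`), and `∫₀^W P(−w) dw = ∫_{−W}^0 P`. -/
theorem germ_symm_eq_integral_fold {a : Dir} (hpos : ∀ k, 0 < h28 a k) {T b : ℝ} (hb : b ∈ bkpts a T)
    (δ : Fin 8 → ℝ) {η : ℝ} (hη : 0 < η) (h1 : η * clusterBound a δ < 1) (h2 : η * clusterBound a δ < wallDist a T)
    {t : ℝ} (ht : 0 < t) (ht1 : t * xMax a < 1) (ht2 : t * xMax a < wallDist a T) :
    germR a δ η b + germL a δ η b + germR a (-δ) η b + germL a (-δ) η b =
      ∫ x in (-clusterWidth a δ)..clusterWidth a δ,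
        ((torusN (b • sParam a + η • (x • sParam a + δ)) : ℝ) + torusN (b • sParam a - η • (x • sParam a + δ)) -
          (torusN (b • sParam a + t • sParam a) + torusN (b • sParam a - t • sParam a))) := by
  rw [germ_symm_eq_integral_refl]
  have hW := clusterWidth_pos hpos δ
  set P : ℝ → ℝ := fun x =>
    (torusN (b • sParam a + η • (x • sParam a + δ)) : ℝ) + torusN (b • sParam a - η • (x • sParam a + δ)) -
      (torusN (b • sParam a + t • sParam a) + torusN (b • sParam a - t • sParam a)) with hP
  -- Step 1: a.e. on `(0, W]` the integrand is `P(w) + P(−w)`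
  have hA : ∫ w in (0 : ℝ)..clusterWidth a δ,
      ((shiftDiff a δ η (b + η * w) + shiftDiff a (-δ) η (b - η * w)) +
        (shiftDiff a (-δ) η (b + η * w) + shiftDiff a δ η (b - η * w))) =
      ∫ w in (0 : ℝ)..clusterWidth a δ, (P w + P (-w)) := by
    refine intervalIntegral.integral_congr_ae (Filter.Eventually.of_forall fun w hwI => ?_)
    rw [uIoc_of_le hW.le] at hwI
    obtain ⟨hw0, hwW⟩ := hwI
    obtain ⟨-, -, hF⟩ := refl_integrand_eq_defects hpos hb δ hη h1 h2 ht ht1 ht2 hw0 hwW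
    rw [hF, hP, (bkpt_disp_mirror a b η w δ).1, (bkpt_disp_mirror a b η w δ).2]
    simp only
    ring
  -- Step 2: integrability of `P` and of its mirror image
  have hPi := fun α β => intervalIntegrable_reflDefect_line a b η t δ α β
  have hPn : IntervalIntegrable (fun w => P (-w)) volume 0 (clusterWidth a δ) := by
    have e : (fun w : ℝ => P (-w)) = fun w : ℝ => (torusN ((b + (-η) * w) • sParam a + η • δ) : ℝ) +
        torusN ((b + η * w) • sParam a + (-η) • δ) -
        (torusN (b • sParam a + t • sParam a) + torusN (b • sParam a - t • sParam a)) := by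
      funext w
      have v1 : b • sParam a + η • ((-w) • sParam a + δ) = (b + (-η) * w) • sParam a + η • δ := by
        ext i; simp only [Pi.add_apply, Pi.smul_apply, smul_eq_mul]; ring
      have v2 : b • sParam a - η • ((-w) • sParam a + δ) = (b + η * w) • sParam a + (-η) • δ := by
        ext i; simp only [Pi.add_apply, Pi.sub_apply, Pi.smul_apply, smul_eq_mul]; ring
      simp only [hP, v1, v2]
    rw [e]
    exact ((intervalIntegrable_torusN_affine a _ b (-η) _ _).add
      (intervalIntegrable_torusN_affine a _ b η _ _)).sub intervalIntegrable_const
  -- Step 3: fold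
  rw [hA, intervalIntegral.integral_add (hPi 0 _) hPn]
  have hneg : ∫ w in (0 : ℝ)..clusterWidth a δ, P (-w) = ∫ w in (-clusterWidth a δ)..0, P w := by
    have h := intervalIntegral.integral_comp_neg (a := 0) (b := clusterWidth a δ) (f := P)
    rw [neg_zero] at h
    exact h
  rw [hneg, add_comm, intervalIntegral.integral_add_adjacent_intervals (hPi _ _) (hPi _ _)]

/-! ### Cell constancy and the vanishing outside the flip range -/

/-- Smallness of the local-line displacement inside the cluster: for `|x| ≤ W` the 28 forms of `η(x·s + δ)` are
`< 1` and `< wallDist a T`. -/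
theorem disp_small {a : Dir} (hpos : ∀ k, 0 < h28 a k) {T : ℝ} (δ : Fin 8 → ℝ) {η : ℝ} (hη : 0 < η)
    (h1 : η * clusterBound a δ < 1) (h2 : η * clusterBound a δ < wallDist a T) {x : ℝ} (hx : |x| ≤ clusterWidth a δ) :
    (∀ k, |phiForm (η • (x • sParam a + δ)) k| < 1) ∧ (∀ k, |phiForm (η • (x • sParam a + δ)) k| < wallDist a T) :=
  ⟨fun k => (abs_phiForm_disp_le hpos δ le_rfl hx hη.le k).trans_lt h1,
    fun k => (abs_phiForm_disp_le hpos δ le_rfl hx hη.le k).trans_lt h2⟩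

/-- **CELL CONSTANCY of the reflected pair along the local line.** Let `b ∈ bkpts a T`, `0 < η`, `ηK < 1`,
`ηK < wallDist a T`, and `x, y ∈ [−W, W]` such that every MEMBER form `x·h_k + φ_k(δ)`, `y·h_k + φ_k(δ)` (`b·h_k ∈ ℤ`) has
the same strict sign at `x` and at `y` (no member flip point between them). Then
`𝒩(θ_b + η(x·s+δ)) + 𝒩(θ_b − η(x·s+δ)) = 𝒩(θ_b + η(y·s+δ)) + 𝒩(θ_b − η(y·s+δ))`. -/
theorem pair_line_eq_of_same_signs {a : Dir} (hpos : ∀ k, 0 < h28 a k) {T b : ℝ} (hb : b ∈ bkpts a T)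
    (δ : Fin 8 → ℝ) {η : ℝ} (hη : 0 < η) (h1 : η * clusterBound a δ < 1) (h2 : η * clusterBound a δ < wallDist a T)
    {x y : ℝ} (hx : |x| ≤ clusterWidth a δ) (hy : |y| ≤ clusterWidth a δ)
    (hsame : ∀ k, (∃ z : ℤ, b * h28 a k = z) →
      (0 < x * h28 a k + phiForm δ k ∧ 0 < y * h28 a k + phiForm δ k) ∨
        (x * h28 a k + phiForm δ k < 0 ∧ y * h28 a k + phiForm δ k < 0)) :
    (torusN (b • sParam a + η • (x • sParam a + δ)) : ℝ) + torusN (b • sParam a - η • (x • sParam a + δ)) =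
      (torusN (b • sParam a + η • (y • sParam a + δ)) : ℝ) + torusN (b • sParam a - η • (y • sParam a + δ)) := by
  obtain ⟨hx1, hx2⟩ := disp_small hpos δ hη h1 h2 hx (T := T)
  obtain ⟨hy1, hy2⟩ := disp_small hpos δ hη h1 h2 hy (T := T)
  exact_mod_cast torusN_pair_eq_of_member_signs hb hx1 hx2 hy1 hy2 fun k hk => by
    rw [phiForm_disp, phiForm_disp]
    rcases hsame k hk with ⟨hp, hp'⟩ | ⟨hn, hn'⟩
    · exact Or.inl ⟨mul_pos hη hp, mul_pos hη hp'⟩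
    · exact Or.inr ⟨mul_neg_of_pos_of_neg hη hn, mul_neg_of_pos_of_neg hη hn'⟩

/-- **CELL CONSTANCY of the reflection defect** `P(x) = 𝒩(θ_b+Δ_x) + 𝒩(θ_b−Δ_x) − (𝒩(θ_b+t·s) + 𝒩(θ_b−t·s))` of the
local line: `P(x) = P(y)` whenever every member form has the same strict sign at `x, y ∈ [−W, W]`
(`pair_line_eq_of_same_signs`; the baseline `t` is arbitrary here). -/
theorem reflDefect_line_eq_of_same_signs {a : Dir} (hpos : ∀ k, 0 < h28 a k) {T b : ℝ} (hb : b ∈ bkpts a T)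
    (δ : Fin 8 → ℝ) {η : ℝ} (hη : 0 < η) (h1 : η * clusterBound a δ < 1) (h2 : η * clusterBound a δ < wallDist a T)
    (t : ℝ) {x y : ℝ} (hx : |x| ≤ clusterWidth a δ) (hy : |y| ≤ clusterWidth a δ)
    (hsame : ∀ k, (∃ z : ℤ, b * h28 a k = z) →
      (0 < x * h28 a k + phiForm δ k ∧ 0 < y * h28 a k + phiForm δ k) ∨
        (x * h28 a k + phiForm δ k < 0 ∧ y * h28 a k + phiForm δ k < 0)) :
    (torusN (b • sParam a + η • (x • sParam a + δ)) : ℝ) + torusN (b • sParam a - η • (x • sParam a + δ)) -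
        (torusN (b • sParam a + t • sParam a) + torusN (b • sParam a - t • sParam a)) =
      (torusN (b • sParam a + η • (y • sParam a + δ)) : ℝ) + torusN (b • sParam a - η • (y • sParam a + δ)) -
        (torusN (b • sParam a + t • sParam a) + torusN (b • sParam a - t • sParam a)) := by
  rw [pair_line_eq_of_same_signs hpos hb δ hη h1 h2 hx hy hsame]

/-- **Right of the last flip point the defect vanishes**: if every member form is positive at `x ∈ [−W, W]`, the
reflected pair of the line at `x` equals the reflected pair of the line step `t` (all members positive there too). -/
theorem reflDefect_line_eq_zero_of_pos {a : Dir} (hpos : ∀ k, 0 < h28 a k) {T b : ℝ} (hb : b ∈ bkpts a T)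
    (δ : Fin 8 → ℝ) {η : ℝ} (hη : 0 < η) (h1 : η * clusterBound a δ < 1) (h2 : η * clusterBound a δ < wallDist a T)
    {t : ℝ} (ht : 0 < t) (ht1 : t * xMax a < 1) (ht2 : t * xMax a < wallDist a T) {x : ℝ}
    (hx : |x| ≤ clusterWidth a δ) (hposx : ∀ k, (∃ z : ℤ, b * h28 a k = z) → 0 < x * h28 a k + phiForm δ k) :
    (torusN (b • sParam a + η • (x • sParam a + δ)) : ℝ) + torusN (b • sParam a - η • (x • sParam a + δ)) -
      (torusN (b • sParam a + t • sParam a) + torusN (b • sParam a - t • sParam a)) = 0 := by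
  rw [sub_eq_zero]
  obtain ⟨hx1, hx2⟩ := disp_small hpos δ hη h1 h2 hx (T := T)
  have hs1 := fun k => phiForm_line_step_small hpos ht ht1 k
  have hs2 := fun k => phiForm_line_step_small hpos ht ht2 k
  exact_mod_cast torusN_pair_eq_of_member_signs hb hx1 hx2 (fun k => (hs1 k).2.2.2.1) (fun k => (hs2 k).2.2.2.1)
    fun k hk => Or.inl ⟨by rw [phiForm_disp]; exact mul_pos hη (hposx k hk),
      by rw [(hs1 k).1]; exact (hs1 k).2.2.1⟩

/-- **Left of the first flip point the defect vanishes**: if every member form is negative at `x ∈ [−W, W]`, the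
reflected pair at `x` equals that of the line step `t` (global reversal, `torusN_pair_eq_of_member_antisigns`). -/
theorem reflDefect_line_eq_zero_of_neg {a : Dir} (hpos : ∀ k, 0 < h28 a k) {T b : ℝ} (hb : b ∈ bkpts a T)
    (δ : Fin 8 → ℝ) {η : ℝ} (hη : 0 < η) (h1 : η * clusterBound a δ < 1) (h2 : η * clusterBound a δ < wallDist a T)
    {t : ℝ} (ht : 0 < t) (ht1 : t * xMax a < 1) (ht2 : t * xMax a < wallDist a T) {x : ℝ}
    (hx : |x| ≤ clusterWidth a δ) (hnegx : ∀ k, (∃ z : ℤ, b * h28 a k = z) → x * h28 a k + phiForm δ k < 0) :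
    (torusN (b • sParam a + η • (x • sParam a + δ)) : ℝ) + torusN (b • sParam a - η • (x • sParam a + δ)) -
      (torusN (b • sParam a + t • sParam a) + torusN (b • sParam a - t • sParam a)) = 0 := by
  rw [sub_eq_zero]
  obtain ⟨hx1, hx2⟩ := disp_small hpos δ hη h1 h2 hx (T := T)
  have hs1 := fun k => phiForm_line_step_small hpos ht ht1 k
  have hs2 := fun k => phiForm_line_step_small hpos ht ht2 k
  exact_mod_cast torusN_pair_eq_of_member_antisigns hb hx1 hx2 (fun k => (hs1 k).2.2.2.1)
    (fun k => (hs2 k).2.2.2.1) fun k hk => Or.inr ⟨by rw [phiForm_disp]; exact mul_neg_of_pos_of_neg hη (hnegx k hk),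
      by rw [(hs1 k).1]; exact (hs1 k).2.2.1⟩

/-! ### Partitions through the flip points and THE EXACT D-FORM -/

/-- A chain `c_0 < c_1 < ⋯ < c_n` is monotone on `[0, n]`. -/
theorem chain_mono {c : ℕ → ℝ} {n : ℕ} (hmono : ∀ j < n, c j < c (j + 1)) {i j : ℕ} (hij : i ≤ j) (hj : j ≤ n) :
    c i ≤ c j := by
  induction j with
  | zero => rw [Nat.le_zero.mp hij]
  | succ m ih =>
    rcases Nat.lt_or_eq_of_le hij with h | h
    · exact (ih (Nat.lt_succ_iff.mp h) (Nat.le_of_succ_le hj)).trans (hmono m (Nat.lt_of_succ_le hj)).le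
    · rw [h]

/-- A chain `c_0 < c_1 < ⋯ < c_n` is strictly monotone on `[0, n]`. -/
theorem chain_strictMono {c : ℕ → ℝ} {n : ℕ} (hmono : ∀ j < n, c j < c (j + 1)) {i j : ℕ} (hij : i < j)
    (hj : j ≤ n) : c i < c j := by
  obtain ⟨m, rfl⟩ := Nat.exists_eq_add_one_of_ne_zero (Nat.ne_zero_of_lt hij)
  exact (chain_mono hmono (Nat.lt_succ_iff.mp hij) (Nat.le_of_succ_le hj)).trans_lt (hmono m (Nat.lt_of_succ_le hj))

/-- **Member signs on a cell of a partition.** Let `c_0 < ⋯ < c_n` pass through every member flip point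
(`hflip`), `j < n`, and `c_j < x < c_{j+1}`. Then the member form `x·h_k + φ_k(δ)` is positive if the member's flip
point is `c_i` with `i ≤ j` and negative if `i ≥ j + 1`; in particular two points of the same open cell see the same
strict member signs. -/
theorem member_signs_on_cell {a : Dir} (hpos : ∀ k, 0 < h28 a k) {b : ℝ} (δ : Fin 8 → ℝ) {n : ℕ} {c : ℕ → ℝ}
    (hmono : ∀ j < n, c j < c (j + 1))
    (hflip : ∀ k, (∃ z : ℤ, b * h28 a k = z) → ∃ i ≤ n, c i = -(phiForm δ k / h28 a k))
    {j : ℕ} (hj : j < n) {x y : ℝ} (hx : c j < x ∧ x < c (j + 1)) (hy : c j < y ∧ y < c (j + 1)) :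
    ∀ k, (∃ z : ℤ, b * h28 a k = z) →
      (0 < x * h28 a k + phiForm δ k ∧ 0 < y * h28 a k + phiForm δ k) ∨
        (x * h28 a k + phiForm δ k < 0 ∧ y * h28 a k + phiForm δ k < 0) := by
  intro k hk
  have hk0 := hpos k
  obtain ⟨i, hin, hci⟩ := hflip k hk
  rw [line_form_eq_mul_sub hk0 hci, line_form_eq_mul_sub hk0 hci]
  rcases le_or_gt i j with hij | hij
  · have hle : c i ≤ c j := chain_mono hmono hij hj.le
    exact Or.inl ⟨mul_pos hk0 (by linarith [hx.1]), mul_pos hk0 (by linarith [hy.1])⟩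
  · have hle : c (j + 1) ≤ c i := chain_mono hmono (Nat.succ_le_of_lt hij) hin
    exact Or.inr ⟨mul_neg_of_pos_of_neg hk0 (by linarith [hx.2]), mul_neg_of_pos_of_neg hk0 (by linarith [hy.2])⟩

/-- **THE EXACT D-FORM AT ANY WALL COUNT.** Let all 28 forms of `a` be positive, `b ∈ bkpts a T`, `δ` a displacement,
`0 < η` with `ηK < 1`, `ηK < wallDist a T`, `t > 0` a line step with `t·x_max < 1`, `t·x_max < wallDist a T`, and let
`−W = c_0 < c_1 < ⋯ < c_n = W` be ANY partition of `[−W, W]` passing through every member flip point `−φ_k(δ)/h_k(a)`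
(`b·h_k(a) ∈ ℤ`). Then
`germR(δ) + germL(δ) + germR(−δ) + germL(−δ) = Σ_{j<n} (c_{j+1} − c_j) · P((c_j + c_{j+1})/2)`,
`P(x) = 𝒩(θ_b + η(x·s+δ)) + 𝒩(θ_b − η(x·s+δ)) − (𝒩(θ_b + t·s) + 𝒩(θ_b − t·s))` the pattern defect of the cell: the
junction's vote in the symmetric part of the cusp slope is a FINITE SUM of (cell length) × (pattern defect). -/
theorem germ_symm_eq_sum_cells {a : Dir} (hpos : ∀ k, 0 < h28 a k) {T b : ℝ} (hb : b ∈ bkpts a T)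
    (δ : Fin 8 → ℝ) {η : ℝ} (hη : 0 < η) (h1 : η * clusterBound a δ < 1) (h2 : η * clusterBound a δ < wallDist a T)
    {t : ℝ} (ht : 0 < t) (ht1 : t * xMax a < 1) (ht2 : t * xMax a < wallDist a T)
    {n : ℕ} {c : ℕ → ℝ} (hc0 : c 0 = -clusterWidth a δ) (hcn : c n = clusterWidth a δ)
    (hmono : ∀ j < n, c j < c (j + 1))
    (hflip : ∀ k, (∃ z : ℤ, b * h28 a k = z) → ∃ i ≤ n, c i = -(phiForm δ k / h28 a k)) :
    germR a δ η b + germL a δ η b + germR a (-δ) η b + germL a (-δ) η b =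
      ∑ j ∈ Finset.range n, (c (j + 1) - c j) *
        ((torusN (b • sParam a + η • (((c j + c (j + 1)) / 2) • sParam a + δ)) : ℝ) +
            torusN (b • sParam a - η • (((c j + c (j + 1)) / 2) • sParam a + δ)) -
          (torusN (b • sParam a + t • sParam a) + torusN (b • sParam a - t • sParam a))) := by
  rw [germ_symm_eq_integral_fold hpos hb δ hη h1 h2 ht ht1 ht2, ← hc0, ← hcn]
  have hPi := fun α β => intervalIntegrable_reflDefect_line a b η t δ α β
  rw [← intervalIntegral.sum_integral_adjacent_intervals fun k _ => hPi (c k) (c (k + 1))]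
  refine Finset.sum_congr rfl fun j hj => ?_
  have hj' : j < n := Finset.mem_range.mp hj
  have hlt : c j < c (j + 1) := hmono j hj'
  -- bounds: the cell lies inside `[−W, W]`
  have hlo : -clusterWidth a δ ≤ c j := by rw [← hc0]; exact chain_mono hmono (Nat.zero_le j) hj'.le
  have hhi : c (j + 1) ≤ clusterWidth a δ := by rw [← hcn]; exact chain_mono hmono (Nat.succ_le_of_lt hj') le_rfl
  have hmid : c j < (c j + c (j + 1)) / 2 ∧ (c j + c (j + 1)) / 2 < c (j + 1) := ⟨by linarith, by linarith⟩
  have hmidW : |(c j + c (j + 1)) / 2| ≤ clusterWidth a δ := abs_le.mpr ⟨by linarith, by linarith⟩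
  -- the defect is constant on the open cell (a.e. on `(c_j, c_{j+1}]`)
  have hcongr : ∫ x in (c j)..(c (j + 1)),
      ((torusN (b • sParam a + η • (x • sParam a + δ)) : ℝ) + torusN (b • sParam a - η • (x • sParam a + δ)) -
        (torusN (b • sParam a + t • sParam a) + torusN (b • sParam a - t • sParam a))) =
      ∫ x in (c j)..(c (j + 1)),
      ((torusN (b • sParam a + η • (((c j + c (j + 1)) / 2) • sParam a + δ)) : ℝ) +
          torusN (b • sParam a - η • (((c j + c (j + 1)) / 2) • sParam a + δ)) -
        (torusN (b • sParam a + t • sParam a) + torusN (b • sParam a - t • sParam a))) := by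
    refine intervalIntegral.integral_congr_ae ?_
    have hae : ∀ᵐ x ∂volume, x ∉ ({c (j + 1)} : Set ℝ) :=
      (measure_eq_zero_iff_ae_notMem).mp (measure_singleton _)
    filter_upwards [hae] with x hxB hxI
    rw [uIoc_of_le hlt.le] at hxI
    have hxlt : x < c (j + 1) := lt_of_le_of_ne hxI.2 fun h => hxB (Set.mem_singleton_iff.mpr h)
    have hxW : |x| ≤ clusterWidth a δ := abs_le.mpr ⟨by linarith [hxI.1], by linarith⟩
    rw [pair_line_eq_of_same_signs hpos hb δ hη h1 h2 hxW hmidW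
      (member_signs_on_cell hpos δ hmono hflip hj' ⟨hxI.1, hxlt⟩ hmid)]
  rw [hcongr, intervalIntegral.integral_const, smul_eq_mul]

/-- **The FIRST cell of a partition through the flip points carries defect `0`** (`0 < n`): its midpoint lies left of
every member flip point (a flip point `c_i` has `i ≠ 0` because `|φ_k(δ)/h_k| < W = −c_0`), so every member form is
negative there. -/
theorem reflDefect_cell_first {a : Dir} (hpos : ∀ k, 0 < h28 a k) {T b : ℝ} (hb : b ∈ bkpts a T)
    (δ : Fin 8 → ℝ) {η : ℝ} (hη : 0 < η) (h1 : η * clusterBound a δ < 1) (h2 : η * clusterBound a δ < wallDist a T)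
    {t : ℝ} (ht : 0 < t) (ht1 : t * xMax a < 1) (ht2 : t * xMax a < wallDist a T)
    {n : ℕ} {c : ℕ → ℝ} (hn : 0 < n) (hc0 : c 0 = -clusterWidth a δ) (hcn : c n = clusterWidth a δ)
    (hmono : ∀ j < n, c j < c (j + 1))
    (hflip : ∀ k, (∃ z : ℤ, b * h28 a k = z) → ∃ i ≤ n, c i = -(phiForm δ k / h28 a k)) :
    (torusN (b • sParam a + η • (((c 0 + c 1) / 2) • sParam a + δ)) : ℝ) +
        torusN (b • sParam a - η • (((c 0 + c 1) / 2) • sParam a + δ)) -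
      (torusN (b • sParam a + t • sParam a) + torusN (b • sParam a - t • sParam a)) = 0 := by
  have hlt : c 0 < c 1 := hmono 0 hn
  have hhi : c 1 ≤ clusterWidth a δ := by rw [← hcn]; exact chain_mono hmono (Nat.succ_le_of_lt hn) le_rfl
  have hmidW : |(c 0 + c 1) / 2| ≤ clusterWidth a δ := abs_le.mpr ⟨by linarith, by linarith⟩
  refine reflDefect_line_eq_zero_of_neg hpos hb δ hη h1 h2 ht ht1 ht2 hmidW fun k hk => ?_
  have hk0 := hpos k
  obtain ⟨i, hin, hci⟩ := hflip k hk
  have hi0 : i ≠ 0 := by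
    rintro rfl
    have hW := abs_flip_lt_clusterWidth hpos δ k
    rw [← neg_neg (phiForm δ k / h28 a k), ← hci, abs_neg, hc0, abs_neg,
      abs_of_pos (clusterWidth_pos hpos δ)] at hW
    exact lt_irrefl _ hW
  have hle : c 1 ≤ c i := chain_mono hmono (Nat.one_le_iff_ne_zero.mpr hi0) hin
  rw [line_form_eq_mul_sub hk0 hci]
  exact mul_neg_of_pos_of_neg hk0 (by linarith)

/-- **The LAST cell of a partition through the flip points carries defect `0`** (`0 < n`): its midpoint lies right of
every member flip point (`i ≠ n` because `|φ_k(δ)/h_k| < W = c_n`), so every member form is positive there. -/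
theorem reflDefect_cell_last {a : Dir} (hpos : ∀ k, 0 < h28 a k) {T b : ℝ} (hb : b ∈ bkpts a T)
    (δ : Fin 8 → ℝ) {η : ℝ} (hη : 0 < η) (h1 : η * clusterBound a δ < 1) (h2 : η * clusterBound a δ < wallDist a T)
    {t : ℝ} (ht : 0 < t) (ht1 : t * xMax a < 1) (ht2 : t * xMax a < wallDist a T)
    {n : ℕ} {c : ℕ → ℝ} (hn : 0 < n) (hc0 : c 0 = -clusterWidth a δ) (hcn : c n = clusterWidth a δ)
    (hmono : ∀ j < n, c j < c (j + 1))
    (hflip : ∀ k, (∃ z : ℤ, b * h28 a k = z) → ∃ i ≤ n, c i = -(phiForm δ k / h28 a k)) :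
    (torusN (b • sParam a + η • (((c (n - 1) + c n) / 2) • sParam a + δ)) : ℝ) +
        torusN (b • sParam a - η • (((c (n - 1) + c n) / 2) • sParam a + δ)) -
      (torusN (b • sParam a + t • sParam a) + torusN (b • sParam a - t • sParam a)) = 0 := by
  have hn1 : n - 1 < n := Nat.sub_lt hn Nat.one_pos
  have hlt : c (n - 1) < c n := by
    have := hmono (n - 1) hn1
    rwa [Nat.sub_add_cancel hn] at this
  have hlo : -clusterWidth a δ ≤ c (n - 1) := by rw [← hc0]; exact chain_mono hmono (Nat.zero_le _) hn1.le
  have hmidW : |(c (n - 1) + c n) / 2| ≤ clusterWidth a δ := abs_le.mpr ⟨by linarith, by linarith⟩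
  refine reflDefect_line_eq_zero_of_pos hpos hb δ hη h1 h2 ht ht1 ht2 hmidW fun k hk => ?_
  have hk0 := hpos k
  obtain ⟨i, hin, hci⟩ := hflip k hk
  have hin' : i ≠ n := by
    rintro rfl
    have hW := abs_flip_lt_clusterWidth hpos δ k
    rw [← neg_neg (phiForm δ k / h28 a k), ← hci, abs_neg, hcn, abs_of_pos (clusterWidth_pos hpos δ)] at hW
    exact lt_irrefl _ hW
  have hle : c i ≤ c (n - 1) := chain_mono hmono (Nat.le_sub_one_of_lt (lt_of_le_of_ne hin hin')) hn1.le
  rw [line_form_eq_mul_sub hk0 hci]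
  exact mul_pos hk0 (by linarith)

end Summit.KontsevichZagierPeriods.Zeta5Search.Barrier.ConeGamma

end
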